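import Summits.Ventures.QEC.Census.CertCoverBatch
import Summits.Ventures.QEC.Census.BB.S8_126_w6_k12_01061B01.CoreDefs
import HarnessLib

set_option Elab.async false
set_option maxRecDepth 200000

/-!
# `[[252,12,16]]` one-level cover certificate of `S8_126_w6_k12_01061B01` — LEVEL-1→0 coset problems 1…9 (deep problems [0] excluded: `ProbDeep*.lean`) as COMPACT data
(`ProbData`: U, f, σ, y₀, allow; qec-type-10 `CertCoverBatch.mkCoset` rebuilds each `CosetProb` in the kernel) + their verdict
`probsOK cov covR hx hx1 D1 lxd 14` (one `decide +kernel`; 9 problems, depths f=0:1 f=1:7 f=2:1 f=3:0, est. 99.5 s).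
qec-search-1 g5 (pattern of search-9 g5 `Probs*`); data from JSON `level10.problems` (sha256 75f002ace624d82a…). Data + decided check; KERNEL.
-/

namespace Summit.Ventures.QEC.Census.S8_126_w6_k12_01061B01

open Matrix Summit.Ventures.QEC.Census Literature.InformationTheory.QuantumCodes

/-- Problems 1…9 (9): `⟨U, f, σ, y₀, allow⟩`. -/
def probs00 : List ProbData := [
    ⟨141702123367538375003136, 1, 3462143038980108288, 56687997460288936871936, [0]⟩,
    ⟨160612341886649634919424, 2, 5770238398300180480, 38046409926903861248, [0, 37778931862957161709568]⟩,
    ⟨425097146730578270233601, 1, 1154049880830808068, 311685411243632462136320, [0]⟩,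
    ⟨614107098199123298374658, 0, 5770242800641724424, 9606141977483760649218, [0]⟩,
    ⟨802960252338643748799490, 1, 1154052082001580040, 160717257742194468471810, [0]⟩,
    ⟨1558686463554774705931268, 1, 1154056484343123984, 1218379775961201412932608, [0]⟩,
    ⟨3070138885987036620194824, 1, 1154065289026211872, 2427305595584626680660992, [0]⟩,
    ⟨6093043730851560448721936, 1, 1154082898392387648, 4873483363278437717377024, [0]⟩,
    ⟨12138853420580608105776160, 1, 1154118117124739200, 2429666778808469317485600, [0]⟩]

set_option maxHeartbeats 400000000 in
/-- Every problem of this chunk passes (`mkCoset` elimination + `cosetOKD` + fast `σ` + depth + `BU`-evenness + label checks). -/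
theorem probs00_ok : probsOK S8_126_w6_k12_01061B01.cov covR hx hx1 D1 lxd 14 probs00 = true := by
  decide +kernel

/-- Pointwise form. -/
theorem probs00_all : ∀ x ∈ S8_126_w6_k12_01061B01.probs00, probOK cov covR hx hx1 D1 lxd 14 x = true := by
  have h := probs00_ok
  rwa [probsOK, List.all_eq_true] at h

end Summit.Ventures.QEC.Census.S8_126_w6_k12_01061B01
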